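import Literature.Analysis.SpecialFunctions.HypergeometricPolynomialOrthogonality
import Mathlib.Topology.ContinuousMap.Weierstrass
import HarnessLib

/-!
# The hypergeometric polynomials span `ℝ[X]`; positivity by testing against squares

Topic `Literature/Analysis/SpecialFunctions` (generic). Sequel of
`HypergeometricPolynomialOrthogonality.lean`; motivation: the order properties of the explicit
solution of LSW's boundary problem behind
`Literature.Probability.Percolation.LawlerSchrammWerner2002_hittingPDE` (LSW (2002), Lemma 2.2),
which are obtained by duality — a function `F` is shown to be `≥ 0` by checking
`∫₀¹ ρ F g ≥ 0` for all polynomials `g ≥ 0`. Two elementary tools: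

* `exists_eq_sum_smul_hypJacobi` — every real polynomial of degree `≤ d` is a combination of
  `y_0, …, y_d` (`deg y_n = n`; `c ∉ {0, -1, …}`);
* `nonneg_of_forall_integral_mul_sq_nonneg` — if `F` is continuous on `(0, 1)`, `ρ F` is
  integrable on `[0, 1]`, and `∫₀¹ ρ F r² ≥ 0` for every polynomial `r`, then `F ≥ 0` on `(0, 1)`
  (Weierstrass approximation of a tent function).

No named fact is introduced.

## References

* G. E. Andrews, R. Askey, R. Roy, *Special Functions*, CUP (1999), Def. 2.5.1.
  [AndrewsAskeyRoy1999]
* G. F. Lawler, O. Schramm, W. Werner, *One-arm exponent for critical 2D percolation*, Electron.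
  J. Probab. 7 (2002), no. 2, Lemma 2.2. [LawlerSchrammWernerEJP2002]
-/

noncomputable section

open Polynomial Set MeasureTheory intervalIntegral Filter
open scoped Topology

namespace Literature.Analysis.SpecialFunctions

/-! ### The `y_n` span the polynomials -/

/-- **Triangularity**: every `p ∈ ℝ[X]` with `deg p ≤ d` is `Σ_{n ≤ d} b_n y_n` for some real
`b_n` (`c ∉ {0, -1, …, -(d-1)}`, so that `deg y_n = n` for `n ≤ d`). [folklore] -/
theorem exists_eq_sum_smul_hypJacobi {c : ℝ} (hc : ∀ k : ℕ, (k : ℝ) + c ≠ 0) :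
    ∀ (d : ℕ) (p : ℝ[X]), p.natDegree ≤ d →
      ∃ b : ℕ → ℝ, p = ∑ n ∈ Finset.range (d + 1), b n • hypJacobi c n := by
  intro d
  induction d with
  | zero =>
    intro p hp
    refine ⟨fun _ => p.coeff 0, ?_⟩
    rw [Finset.sum_range_one, hypJacobi_zero, smul_eq_C_mul, mul_one]
    exact eq_C_of_natDegree_le_zero hp
  | succ d ih =>
    intro p hp
    set ℓ := hypJacobiCoeff c (d + 1) (d + 1) with hℓ
    have hℓ0 : ℓ ≠ 0 := hypJacobiCoeff_ne_zero (fun k _ => hc k) le_rfl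
    set t := p.coeff (d + 1) / ℓ with ht
    set q := p - t • hypJacobi c (d + 1) with hq
    have hqdeg : q.natDegree ≤ d := by
      rw [natDegree_le_iff_coeff_eq_zero]
      intro m hm
      rw [hq, coeff_sub, coeff_smul, coeff_hypJacobi, smul_eq_mul]
      rcases (Nat.succ_le_of_lt hm).eq_or_lt with hdm | hdm
      · rw [← hdm, ← hℓ, ht, div_mul_cancel₀ _ hℓ0, sub_self]
      · rw [hypJacobiCoeff_eq_zero_of_lt c hdm, mul_zero, sub_zero]
        exact coeff_eq_zero_of_natDegree_lt (hp.trans_lt hdm)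
    obtain ⟨b, hb⟩ := ih q hqdeg
    refine ⟨fun n => if n = d + 1 then t else b n, ?_⟩
    rw [Finset.sum_range_succ]
    dsimp only
    rw [if_pos rfl]
    have : ∑ n ∈ Finset.range (d + 1), (if n = d + 1 then t else b n) • hypJacobi c n
        = ∑ n ∈ Finset.range (d + 1), b n • hypJacobi c n :=
      Finset.sum_congr rfl fun n hn => by
        rw [if_neg (Finset.mem_range.1 hn).ne]
    rw [this, ← hb, hq]
    abel

/-- Pointwise form: `p(z) = Σ_{n ≤ d} b_n y_n(z)`. [folklore] -/
theorem exists_eval_eq_sum_hypJacobi {c : ℝ} (hc : ∀ k : ℕ, (k : ℝ) + c ≠ 0) (p : ℝ[X]) :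
    ∃ (d : ℕ) (b : ℕ → ℝ), ∀ z : ℝ,
      p.eval z = ∑ n ∈ Finset.range (d + 1), b n * (hypJacobi c n).eval z := by
  obtain ⟨b, hb⟩ := exists_eq_sum_smul_hypJacobi hc p.natDegree p le_rfl
  refine ⟨p.natDegree, b, fun z => ?_⟩
  conv_lhs => rw [hb]
  simp [eval_finsetSum, eval_smul, smul_eq_mul]

/-! ### The tent function -/

/-- The tent `β(z) = max(0, 1 - |z - z₀|/δ)`. [folklore] -/
def tent (z₀ δ z : ℝ) : ℝ := max 0 (1 - |z - z₀| / δ)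

/-- The tent is continuous. [folklore] -/
theorem continuous_tent (z₀ : ℝ) {δ : ℝ} : Continuous (tent z₀ δ) := by
  unfold tent; fun_prop

/-- `0 ≤ β ≤ 1`. [folklore] -/
theorem tent_mem_Icc (z₀ : ℝ) {δ : ℝ} (hδ : 0 < δ) (z : ℝ) : tent z₀ δ z ∈ Icc (0 : ℝ) 1 := by
  unfold tent
  refine ⟨le_max_left _ _, max_le zero_le_one ?_⟩
  have : 0 ≤ |z - z₀| / δ := by positivity
  linarith

/-- `β = 0` outside `(z₀ - δ, z₀ + δ)`. [folklore] -/
theorem tent_eq_zero (z₀ : ℝ) {δ : ℝ} (hδ : 0 < δ) {z : ℝ} (hz : δ ≤ |z - z₀|) : tent z₀ δ z = 0 := by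
  unfold tent
  refine max_eq_left ?_
  rw [sub_nonpos, le_div_iff₀ hδ, one_mul]
  exact hz

/-- `β ≥ 1/2` on `[z₀ - δ/2, z₀ + δ/2]`. [folklore] -/
theorem half_le_tent (z₀ : ℝ) {δ : ℝ} (hδ : 0 < δ) {z : ℝ} (hz : |z - z₀| ≤ δ / 2) :
    1 / 2 ≤ tent z₀ δ z := by
  unfold tent
  refine le_max_of_le_right ?_
  have : |z - z₀| / δ ≤ 1 / 2 := by rw [div_le_iff₀ hδ]; linarith
  linarith

/-! ### Positivity by testing against squares of polynomials -/

/-- **Positivity by duality.** Let `1 < c < 2`, let `F` be continuous on `(0, 1)` with `ρ F`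
integrable on `[0, 1]`, and suppose `∫₀¹ ρ F r² ≥ 0` for every real polynomial `r`. Then `F ≥ 0`
on `(0, 1)`. (If `F(z₀) < 0`, approximate the tent at `z₀` uniformly by a polynomial `r`
(Weierstrass); then `∫ ρ F r² < 0`.) [folklore] -/
theorem nonneg_of_forall_integral_mul_sq_nonneg {c : ℝ} (hc : 1 < c) (hc2 : c < 2) {F : ℝ → ℝ}
    (hF : ContinuousOn F (Ioo 0 1))
    (hint : IntervalIntegrable (fun z => jacobiWeight c z * F z) volume 0 1)
    (hpos : ∀ r : ℝ[X], 0 ≤ ∫ z in (0 : ℝ)..1, jacobiWeight c z * F z * (r.eval z) ^ 2)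
    {z₀ : ℝ} (hz₀ : z₀ ∈ Ioo (0 : ℝ) 1) : 0 ≤ F z₀ := by
  by_contra hneg
  push Not at hneg
  set ε := -F z₀ / 2 with hε
  have hε0 : 0 < ε := by rw [hε]; linarith
  -- `F < -ε` on a neighbourhood `[z₀ - δ, z₀ + δ] ⊆ (0, 1)`
  have hFat : ContinuousAt F z₀ := hF.continuousAt (Ioo_mem_nhds hz₀.1 hz₀.2)
  have hev : ∀ᶠ z in 𝓝 z₀, F z < -ε := hFat.eventually (gt_mem_nhds (by rw [hε]; linarith))
  obtain ⟨δ₀, hδ₀, hball⟩ := Metric.eventually_nhds_iff.1 hev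
  set δ := min (δ₀ / 2) (min (z₀ / 2) ((1 - z₀) / 2)) with hδdef
  have hδ : 0 < δ := lt_min (by linarith) (lt_min (by linarith [hz₀.1]) (by linarith [hz₀.2]))
  have hδ₁ : δ ≤ δ₀ / 2 := min_le_left _ _
  have hδ₂ : δ ≤ z₀ / 2 := (min_le_right _ _).trans (min_le_left _ _)
  have hδ₃ : δ ≤ (1 - z₀) / 2 := (min_le_right _ _).trans (min_le_right _ _)
  have hFneg : ∀ z, |z - z₀| < δ₀ → F z < -ε := fun z hz => hball (by rwa [Real.dist_eq])
  -- integrability helpers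
  have hρ := intervalIntegrable_jacobiWeight hc.le hc2
  have hintF : IntervalIntegrable (fun z => |jacobiWeight c z * F z|) volume 0 1 := hint.abs
  set J := ∫ z in (0 : ℝ)..1, |jacobiWeight c z * F z| with hJ
  have hJ0 : 0 ≤ J := intervalIntegral.integral_nonneg zero_le_one fun z _ => abs_nonneg _
  -- the positive mass of `ρ` on the middle interval
  set a' := z₀ - δ / 2 with ha'
  set b' := z₀ + δ / 2 with hb'
  have hab' : a' < b' := by rw [ha', hb']; linarith
  have ha'0 : 0 < a' := by rw [ha']; linarith
  have hb'1 : b' < 1 := by rw [hb']; linarith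
  set m := ∫ z in a'..b', jacobiWeight c z with hm
  have hm0 : 0 < m := by
    refine intervalIntegral.intervalIntegral_pos_of_pos_on
      (hρ.mono_set ?_) (fun z hz => jacobiWeight_pos c ⟨ha'0.trans hz.1, hz.2.trans hb'1⟩) hab'
    rw [uIcc_of_le hab'.le, uIcc_of_le zero_le_one]
    exact Icc_subset_Icc ha'0.le hb'1.le
  -- Weierstrass
  set κ₀ := ε / 4 * m with hκ₀
  have hκ₀0 : 0 < κ₀ := by positivity
  set η := min (1 : ℝ) (κ₀ / (3 * J + 1)) with hη
  have hη0 : 0 < η := lt_min one_pos (by positivity)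
  have hη1 : η ≤ 1 := min_le_left _ _
  have hηJ : 3 * η * J < κ₀ := by
    have h1 : η ≤ κ₀ / (3 * J + 1) := min_le_right _ _
    have h2 : η * (3 * J + 1) ≤ κ₀ := by rwa [le_div_iff₀ (by positivity)] at h1
    nlinarith
  obtain ⟨r, hr⟩ := exists_polynomial_near_of_continuousOn 0 1 (tent z₀ δ)
    (continuous_tent z₀).continuousOn η hη0
  -- abbreviations
  set β := tent z₀ δ with hβ
  have hβc : Continuous β := continuous_tent z₀
  have hβ01 := fun z => tent_mem_Icc z₀ hδ z
  have hrc : Continuous fun z => r.eval z := (Polynomial.differentiable r).continuous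
  -- `|r² - β²| ≤ 3η` on `[0,1]`
  have hdiff : ∀ z ∈ Icc (0 : ℝ) 1, |(r.eval z) ^ 2 - (β z) ^ 2| ≤ 3 * η := by
    intro z hz
    have h1 : |r.eval z - β z| < η := hr z hz
    have hβz := hβ01 z
    have h2 : |r.eval z + β z| ≤ 2 + η := by
      have : |r.eval z| ≤ 1 + η := by
        calc |r.eval z| = |(r.eval z - β z) + β z| := by ring_nf
          _ ≤ |r.eval z - β z| + |β z| := abs_add_le _ _
          _ ≤ η + 1 := by
              rw [abs_of_nonneg hβz.1]; linarith [hβz.2]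
          _ = 1 + η := by ring
      calc |r.eval z + β z| ≤ |r.eval z| + |β z| := abs_add_le _ _
        _ ≤ (1 + η) + 1 := by rw [abs_of_nonneg hβz.1]; linarith [hβz.2]
        _ = 2 + η := by ring
    rw [sq_sub_sq, abs_mul]
    calc |r.eval z + β z| * |r.eval z - β z| ≤ (2 + η) * η :=
          mul_le_mul h2 h1.le (abs_nonneg _) (by linarith)
      _ ≤ 3 * η := by nlinarith
  -- split `∫ ρ F r² = ∫ ρ F β² + ∫ ρ F (r² - β²)`
  have hi_r : IntervalIntegrable (fun z => jacobiWeight c z * F z * (r.eval z) ^ 2) volume 0 1 :=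
    hint.mul_continuousOn (hrc.pow 2).continuousOn
  have hi_β : IntervalIntegrable (fun z => jacobiWeight c z * F z * (β z) ^ 2) volume 0 1 :=
    hint.mul_continuousOn (hβc.pow 2).continuousOn
  have hi_d : IntervalIntegrable
      (fun z => jacobiWeight c z * F z * ((r.eval z) ^ 2 - (β z) ^ 2)) volume 0 1 :=
    hint.mul_continuousOn ((hrc.pow 2).sub (hβc.pow 2)).continuousOn
  have hsplit : ∫ z in (0 : ℝ)..1, jacobiWeight c z * F z * (r.eval z) ^ 2
      = (∫ z in (0 : ℝ)..1, jacobiWeight c z * F z * (β z) ^ 2)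
        + ∫ z in (0 : ℝ)..1, jacobiWeight c z * F z * ((r.eval z) ^ 2 - (β z) ^ 2) := by
    rw [← intervalIntegral.integral_add hi_β hi_d]
    exact intervalIntegral.integral_congr fun z _ => by ring
  -- (i) the tent part is `≤ -κ₀`
  have hnonpos : ∀ z ∈ Icc (0 : ℝ) 1, jacobiWeight c z * F z * (β z) ^ 2 ≤ 0 := by
    intro z hz
    by_cases hzz : δ ≤ |z - z₀|
    · rw [hβ, tent_eq_zero z₀ hδ hzz]; simp
    · push Not at hzz
      have hFz : F z < -ε := hFneg z (by linarith)
      have : F z * (β z) ^ 2 ≤ 0 := mul_nonpos_of_nonpos_of_nonneg (by linarith) (sq_nonneg _)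
      calc jacobiWeight c z * F z * (β z) ^ 2 = jacobiWeight c z * (F z * (β z) ^ 2) := by ring
        _ ≤ 0 := mul_nonpos_of_nonneg_of_nonpos (jacobiWeight_nonneg c hz) this
  have hI1 : ∫ z in (0 : ℝ)..1, jacobiWeight c z * F z * (β z) ^ 2 ≤ -κ₀ := by
    have hsub1 : uIcc 0 a' ⊆ uIcc (0 : ℝ) 1 := by
      rw [uIcc_of_le ha'0.le, uIcc_of_le zero_le_one]; exact Icc_subset_Icc le_rfl (by linarith)
    have hsub2 : uIcc a' b' ⊆ uIcc (0 : ℝ) 1 := by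
      rw [uIcc_of_le hab'.le, uIcc_of_le zero_le_one]; exact Icc_subset_Icc ha'0.le hb'1.le
    have hsub3 : uIcc b' 1 ⊆ uIcc (0 : ℝ) 1 := by
      rw [uIcc_of_le hb'1.le, uIcc_of_le zero_le_one]; exact Icc_subset_Icc (by linarith) le_rfl
    rw [← intervalIntegral.integral_add_adjacent_intervals (hi_β.mono_set hsub1)
        ((hi_β.mono_set hsub2).trans (hi_β.mono_set hsub3)),
      ← intervalIntegral.integral_add_adjacent_intervals (hi_β.mono_set hsub2) (hi_β.mono_set hsub3)]
    have h1 : ∫ z in (0 : ℝ)..a', jacobiWeight c z * F z * (β z) ^ 2 ≤ 0 := by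
      have := intervalIntegral.integral_mono_on ha'0.le (hi_β.mono_set hsub1)
        intervalIntegrable_const (g := fun _ => (0 : ℝ))
        (fun z hz => hnonpos z ⟨hz.1, hz.2.trans (by linarith)⟩)
      simpa using this
    have h3 : ∫ z in b'..1, jacobiWeight c z * F z * (β z) ^ 2 ≤ 0 := by
      have := intervalIntegral.integral_mono_on hb'1.le (hi_β.mono_set hsub3)
        intervalIntegrable_const (g := fun _ => (0 : ℝ))
        (fun z hz => hnonpos z ⟨by linarith [hz.1], hz.2⟩)
      simpa using this
    have h2 : ∫ z in a'..b', jacobiWeight c z * F z * (β z) ^ 2 ≤ -κ₀ := by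
      have hle : ∫ z in a'..b', jacobiWeight c z * F z * (β z) ^ 2
          ≤ ∫ z in a'..b', -(ε / 4) * jacobiWeight c z := by
        refine intervalIntegral.integral_mono_on hab'.le (hi_β.mono_set hsub2)
          ((hρ.mono_set hsub2).const_mul _) fun z hz => ?_
        have hzδ : |z - z₀| ≤ δ / 2 := by
          rw [abs_le]; constructor <;> [linarith [hz.1]; linarith [hz.2]]
        have hFz : F z < -ε := hFneg z (by linarith [abs_nonneg (z - z₀)])
        have hβz : 1 / 2 ≤ β z := half_le_tent z₀ hδ hzδ
        have hβ2 : 1 / 4 ≤ (β z) ^ 2 := by nlinarith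
        have hρz : 0 ≤ jacobiWeight c z :=
          jacobiWeight_nonneg c ⟨ha'0.le.trans hz.1, hz.2.trans hb'1.le⟩
        have : F z * (β z) ^ 2 ≤ -(ε / 4) := by nlinarith
        calc jacobiWeight c z * F z * (β z) ^ 2 = jacobiWeight c z * (F z * (β z) ^ 2) := by ring
          _ ≤ jacobiWeight c z * (-(ε / 4)) := mul_le_mul_of_nonneg_left this hρz
          _ = -(ε / 4) * jacobiWeight c z := by ring
      rw [intervalIntegral.integral_const_mul] at hle
      rw [hκ₀]
      linarith
    linarith
  -- (ii) the error part is `≤ 3ηJ`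
  have hI2 : ∫ z in (0 : ℝ)..1, jacobiWeight c z * F z * ((r.eval z) ^ 2 - (β z) ^ 2)
      ≤ 3 * η * J := by
    calc _ ≤ |∫ z in (0 : ℝ)..1, jacobiWeight c z * F z * ((r.eval z) ^ 2 - (β z) ^ 2)| :=
          le_abs_self _
      _ ≤ ∫ z in (0 : ℝ)..1, |jacobiWeight c z * F z * ((r.eval z) ^ 2 - (β z) ^ 2)| :=
          intervalIntegral.abs_integral_le_integral_abs zero_le_one
      _ ≤ ∫ z in (0 : ℝ)..1, 3 * η * |jacobiWeight c z * F z| := by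
          refine intervalIntegral.integral_mono_on zero_le_one hi_d.abs (hintF.const_mul _)
            fun z hz => ?_
          rw [abs_mul]
          calc |jacobiWeight c z * F z| * |(r.eval z) ^ 2 - (β z) ^ 2|
                ≤ |jacobiWeight c z * F z| * (3 * η) :=
                  mul_le_mul_of_nonneg_left (hdiff z hz) (abs_nonneg _)
            _ = 3 * η * |jacobiWeight c z * F z| := by ring
      _ = 3 * η * J := intervalIntegral.integral_const_mul _ _
  have := hpos r
  rw [hsplit] at this
  linarith

end Literature.Analysis.SpecialFunctions
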